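import Summits.ABC.IUTFork.Joshi.TestGenuinePinsCriterionAnyThetaIdeles
import HarnessLib

/-!
# Branch E TEST — THE Y-26 CRITERION AT THE VERBATIM-VOLUME TWIN `settingDHVolSharp`: the pins do not read the volume weights

Proof-only file (abc-iut cell, D-0079 R-J «Joshi Y-discharge census», row Y-26, E-t42 lineage after R-65 / R-70 / R-73 / R-78; seat abc-iut-E-t42,
gen 9; 0 definitions, 0 instances, no `Prop` fact, FACT rows used: none; everything BY NAME).  The Y-26 word of record is stated at
abc-iut-c312-7's PACKET-NORMALISED sharp carrier `Real.settingPrVolSharp` (probability weights, `situationPrVol`); abc-iut-c312-3's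
VERBATIM-VOLUME twin `Real.settingDHVolSharp` (constant weights `1/[F:ℚ]^{j+1}`, `situationDHVol`) carries only abc-iut-w4-d087's partial
negatives (`Cor312PinnedThetaRealSharpNegative*`: one tame quadratically ramified place off `S` ⟹ EMPTY).  The two carriers share the log-shell
signature `logShellsDH X logv`, the field-factor pieces (`factorIdxDH` / `factorFieldDH` / `factorMapDH`) and the idele boxes (`thetaBoxDH (sharpBoxDH t)`,
`qCentreDH tq`) BY NAME — they differ ONLY in the weights of the log-volume, which the pins `(hρ) ∧ (pΘ) ∧ (pq′)` (and the link pin) never read.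
Hence, for every column structure `col`, every `ρ`, `qK`:

* **`pinnedRegions_settingDHVolSharp_iff_settingPrVolSharp`** (`Iff.rfl`, any column structure `col`), with `thetaPinned_…`, `qPinned_…`, `linkPinned_…`,
  `pinnedRegions3_…` twins, and the Y-26-frame twins `pinnedRegions{,3}_ofShells_settingDHVolSharp_iff_settingPrVolSharp` — the pins at the two sharp
  carriers are LITERALLY the same proposition;
* **`exists_pinnedRegions_settingDHVolSharp_iff_finrank_eq_one`** — the Y-26 criterion at `settingDHVolSharp` over the Dupuy–Hilado-weighted frame
  `LatticeSituation.ofShells (logShellsDH X (analyticLogv F)) … (summandPiecesDH …).Adm (summandPiecesDH …).logvol …`: `(∃ ρ qK, PinnedRegions …) ↔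
  [F:ℚ] = 1` for EVERY Θ-ideles `t` (★ p527356 `GenuinePinsAnyTheta.…₀` transported along the `Iff.rfl`); `forall_not_…_iff_one_lt_finrank`;
  three-pin `exists_pinnedRegions3_settingDHVolSharp_iff_finrank_eq_one_and_nonempty_equiv` (★ p524016's residual binder) and `…_unit_iff_finrank_eq_one`;
* `not_pinnedRegions_settingDHVolSharp_of_one_lt_finrank` — w4-d087's tame-place negatives at `settingDHVolSharp` are the case `1 < [F:ℚ]` of the
  criterion (no place hypothesis at all).

READING (tree currency; located, not adjudicated; COUNT-NEUTRAL).  The Y-26 word «genuine-carrier pins INHABITED ⟺ F = ℚ» holds verbatim at BOTH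
volume normalisations of the sharp real carrier (this is NOT the located attach point A3, which concerns the q-idele's divisor `htq`/`htqJ`, not the
weights).  **No side is taken** on [IUTchIII] Cor. 3.12 / [IUTchIV] Thm. 1.10 or on any author (Mochizuki / Scholze–Stix / Joshi / Dupuy–Hilado);
typed ≠ proved; instantiated ≠ endorsed; NOT an abc claim. [claim: Mochizuki2012, status: disputed] [cite: DupuyHilado2025, §3.6, §3.7, §3.9, §4.9]
-/

noncomputable section

open Set Function NumberField IsDedekindDomain Metric
open scoped Pointwise Classical

namespace Summit.ABC.IUTFork.Joshi

namespace GenuinePinsDHNormalisation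

open Thm311 Thm311.Real Cor312 Cor312Vol Literature.IUT.LogThetaLattice Literature.IUT.LogVolume
  Literature.IUT.HodgeTheaters Literature.NumberTheory.NumberFields GenuinePinsLinkPin GenuinePinsAnyTheta

/-! ## 1. The pins at the two sharp carriers are the same proposition -/

section Bridge

variable {F : Type} [Field F] [NumberField F] (X : PilotData F) {logv : PadicLogs F} (hlog : LogvAnalytic logv)
  (M : Type) [Field M] [NumberField M]
  (archPk : ∀ (j : (thetaIndex X).Label) (vQ : (thetaIndex X).VQ), Set ((logShellsDH X logv).Packet j vQ))
  (archSub : ∀ (j : (thetaIndex X).Label) (v : (thetaIndex X).V),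
    Set ((logShellsDH X logv).Packet j ((thetaIndex X).over v)))
  (Ψ : ℤ → ∀ v : (thetaIndex X).V, v ∈ (thetaIndex X).Vbad → Set ((logShellsDH X logv).StarPacket v))
  (act : ℤ → ∀ v : (thetaIndex X).V, v ∈ (thetaIndex X).Vbad →
    (logShellsDH X logv).StarPacket v → Module.End ℚ ((logShellsDH X logv).StarPacket v))
  (Mmod : ℤ → ∀ j : (thetaIndex X).LabelStar, Set ((logShellsDH X logv).GlobalPacket j.1))
  (region : ℤ → ∀ j : (thetaIndex X).LabelStar, FinDivisor M → ∀ vQ : (thetaIndex X).VQ,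
    Set ((logShellsDH X logv).Packet j.1 vQ))
  (n : ℤ) {HT : Type} {LogLink : HT → HT → Type} {IsFull : ∀ {s t : HT}, LogLink s t → Prop}
  (lat : LGPGaussianLogThetaLattice LogLink IsFull)
  {Frd : Type} {IsoF : Frd → Frd → Type} {Ob : Frd → Type} {realify : Frd → Frd} {Strip : Type}
  {IsoS : Strip → Strip → Type} {Mv : ∀ v : (thetaIndex X).V, v ∈ (thetaIndex X).Vbad → Type}
  [∀ v h, Monoid (Mv v h)]
  (sig : GlobalLGPFrobenioidSignature (thetaIndex X).lstar (thetaIndex X).V (· ∈ (thetaIndex X).Vbad)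
    Frd IsoF Ob realify Strip IsoS Mv)
  (split : SplittingMonoids Mv) {ObΔ : Type} {N : ∀ v : (thetaIndex X).V, v ∈ (thetaIndex X).Vbad → Type}
  [∀ v h, Monoid (N v h)] (qData : QPilotData ObΔ N)
  (t : ∀ (pp : Nat.Primes) (_ : Fin X.lstar) (x : (thetaIndex X).Fibre (.inr pp)),
    haveI : Fact (pp : ℕ).Prime := ⟨pp.2⟩; kOf X pp.1 x)
  (tq : ∀ (pp : Nat.Primes) (x : (thetaIndex X).Fibre (.inr pp)), haveI : Fact (pp : ℕ).Prime := ⟨pp.2⟩; kOf X pp.1 x)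
  (htq0 : ∀ pp x, tq pp x ≠ 0)
  (htq1 : ∀ (pp : Nat.Primes) (x : (thetaIndex X).Fibre (.inr pp)),
    haveI : Fact (pp : ℕ).Prime := ⟨pp.2⟩; placeOf X pp.1 x ∉ X.S → ‖tq pp x‖ = 1)
  (col : ℤ → Column (logShellsDH X logv))
  (ρ : (∀ v : (thetaIndex X).V, v ∈ (thetaIndex X).Vbad → Set ((logShellsDH X logv).StarPacket v)) →
    ∀ (j : (thetaIndex X).Label) (vQ : (thetaIndex X).VQ), Set ((logShellsDH X logv).Packet j vQ))
  (qK : ∀ v : (thetaIndex X).V, v ∈ (thetaIndex X).Vbad → Set ((logShellsDH X logv).StarPacket v))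

/-- Every Kummer image of the Θ-pilot object is the SAME set at the two sharp carriers (same boxes, same comparison). [folklore] -/
theorem thetaRegion_settingDHVolSharp_eq_settingPrVolSharp (m : ℤ) (j : (thetaIndex X).Label) (vQ : (thetaIndex X).VQ) :
    (settingDHVolSharp X hlog M archPk archSub Ψ act Mmod region n lat sig split qData tq t htq0 htq1).thetaRegion m j vQ =
      (settingPrVolSharp X hlog M archPk archSub Ψ act Mmod region n lat sig split qData tq t htq0 htq1).thetaRegion m j vQ :=
  rfl

/-- … and so is the q-pilot region. [folklore] -/
theorem qRegion_settingDHVolSharp_eq_settingPrVolSharp (j : (thetaIndex X).Label) (vQ : (thetaIndex X).VQ) :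
    (settingDHVolSharp X hlog M archPk archSub Ψ act Mmod region n lat sig split qData tq t htq0 htq1).qRegion j vQ =
      (settingPrVolSharp X hlog M archPk archSub Ψ act Mmod region n lat sig split qData tq t htq0 htq1).qRegion j vQ :=
  rfl

/-- **The Θ-pin at the two sharp carriers is the same proposition** (it reads `ρ`, the shells' (Ind1)/(Ind2), the columns and the Θ-regions
— never the weights). [claim: Mochizuki2012, status: disputed] -/
theorem thetaPinned_settingDHVolSharp_iff_settingPrVolSharp :
    ThetaPinned ({ toSituation := situationDHVol X hlog M archPk archSub Ψ act Mmod region, col := col } : LatticeSituation (thetaIndex X))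
        (settingDHVolSharp X hlog M archPk archSub Ψ act Mmod region n lat sig split qData tq t htq0 htq1) ρ ↔
      ThetaPinned ({ toSituation := situationPrVol X hlog M archPk archSub Ψ act Mmod region, col := col } : LatticeSituation (thetaIndex X))
        (settingPrVolSharp X hlog M archPk archSub Ψ act Mmod region n lat sig split qData tq t htq0 htq1) ρ :=
  Iff.rfl

/-- **The q-pin likewise.** [claim: Mochizuki2012, status: disputed] -/
theorem qPinned_settingDHVolSharp_iff_settingPrVolSharp :
    QPinned ({ toSituation := situationDHVol X hlog M archPk archSub Ψ act Mmod region, col := col } : LatticeSituation (thetaIndex X))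
        (settingDHVolSharp X hlog M archPk archSub Ψ act Mmod region n lat sig split qData tq t htq0 htq1) ρ qK ↔
      QPinned ({ toSituation := situationPrVol X hlog M archPk archSub Ψ act Mmod region, col := col } : LatticeSituation (thetaIndex X))
        (settingPrVolSharp X hlog M archPk archSub Ψ act Mmod region n lat sig split qData tq t htq0 htq1) ρ qK :=
  Iff.rfl

/-- **`PinnedRegions` at `settingDHVolSharp` ⟺ `PinnedRegions` at `settingPrVolSharp`** — literally the same proposition. [claim: Mochizuki2012, status: disputed] -/
theorem pinnedRegions_settingDHVolSharp_iff_settingPrVolSharp :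
    PinnedRegions ({ toSituation := situationDHVol X hlog M archPk archSub Ψ act Mmod region, col := col } : LatticeSituation (thetaIndex X))
        (settingDHVolSharp X hlog M archPk archSub Ψ act Mmod region n lat sig split qData tq t htq0 htq1) ρ qK ↔
      PinnedRegions ({ toSituation := situationPrVol X hlog M archPk archSub Ψ act Mmod region, col := col } : LatticeSituation (thetaIndex X))
        (settingPrVolSharp X hlog M archPk archSub Ψ act Mmod region n lat sig split qData tq t htq0 htq1) ρ qK :=
  Iff.rfl

/-- The link pin too (same context binders `sig`/`qData`; ★ p524016's residual binder on both sides). [claim: Mochizuki2012, status: disputed] -/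
theorem linkPinned_settingDHVolSharp_iff_settingPrVolSharp :
    LinkPinned ({ toSituation := situationDHVol X hlog M archPk archSub Ψ act Mmod region, col := col } : LatticeSituation (thetaIndex X))
        (settingDHVolSharp X hlog M archPk archSub Ψ act Mmod region n lat sig split qData tq t htq0 htq1) ↔
      LinkPinned ({ toSituation := situationPrVol X hlog M archPk archSub Ψ act Mmod region, col := col } : LatticeSituation (thetaIndex X))
        (settingPrVolSharp X hlog M archPk archSub Ψ act Mmod region n lat sig split qData tq t htq0 htq1) :=
  Iff.rfl

/-- **`PinnedRegions3` likewise.** [claim: Mochizuki2012, status: disputed] -/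
theorem pinnedRegions3_settingDHVolSharp_iff_settingPrVolSharp :
    PinnedRegions3 ({ toSituation := situationDHVol X hlog M archPk archSub Ψ act Mmod region, col := col } : LatticeSituation (thetaIndex X))
        (settingDHVolSharp X hlog M archPk archSub Ψ act Mmod region n lat sig split qData tq t htq0 htq1) ρ qK ↔
      PinnedRegions3 ({ toSituation := situationPrVol X hlog M archPk archSub Ψ act Mmod region, col := col } : LatticeSituation (thetaIndex X))
        (settingPrVolSharp X hlog M archPk archSub Ψ act Mmod region n lat sig split qData tq t htq0 htq1) ρ qK :=
  Iff.rfl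

end Bridge

/-! ## 2. The Y-26 criterion at `settingDHVolSharp` -/

section Criterion

variable {F : Type} [Field F] [NumberField F] (X : PilotData F)
  (M : Type) [Field M] [NumberField M]
  (archPk : ∀ (j : (thetaIndex X).Label) (vQ : (thetaIndex X).VQ), Set ((logShellsDH X (analyticLogv F)).Packet j vQ))
  (archSub : ∀ (j : (thetaIndex X).Label) (v : (thetaIndex X).V),
    Set ((logShellsDH X (analyticLogv F)).Packet j ((thetaIndex X).over v)))
  (Ψ : ℤ → ∀ v : (thetaIndex X).V, v ∈ (thetaIndex X).Vbad → Set ((logShellsDH X (analyticLogv F)).StarPacket v))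
  (act : ℤ → ∀ v : (thetaIndex X).V, v ∈ (thetaIndex X).Vbad →
    (logShellsDH X (analyticLogv F)).StarPacket v → Module.End ℚ ((logShellsDH X (analyticLogv F)).StarPacket v))
  (Mmod : ℤ → ∀ j : (thetaIndex X).LabelStar, Set ((logShellsDH X (analyticLogv F)).GlobalPacket j.1))
  (region : ℤ → ∀ j : (thetaIndex X).LabelStar, FinDivisor M → ∀ vQ : (thetaIndex X).VQ,
    Set ((logShellsDH X (analyticLogv F)).Packet j.1 vQ))
  (frobAdm : ℤ → ℤ → ∀ (j : (thetaIndex X).Label) (vQ : (thetaIndex X).VQ),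
    Set ((logShellsDH X (analyticLogv F)).Packet j vQ) → Prop)
  (frobLogvol : ℤ → ℤ → ∀ (j : (thetaIndex X).Label) (vQ : (thetaIndex X).VQ),
    Set ((logShellsDH X (analyticLogv F)).Packet j vQ) → ℝ)
  (frobΨ : ℤ → ℤ → ∀ v : (thetaIndex X).V, v ∈ (thetaIndex X).Vbad → Set ((logShellsDH X (analyticLogv F)).StarPacket v))
  (frobMmod : ℤ → ℤ → ∀ j : (thetaIndex X).LabelStar, Set ((logShellsDH X (analyticLogv F)).GlobalPacket j.1))
  (unitImage : ℤ → ℤ → ℕ → ∀ (j : (thetaIndex X).Label) (vQ : (thetaIndex X).VQ),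
    Set ((logShellsDH X (analyticLogv F)).Packet j vQ))
  (ballImage : ℤ → ℤ → ∀ (j : (thetaIndex X).Label) (vQ : (thetaIndex X).VQ),
    Set ((logShellsDH X (analyticLogv F)).Packet j vQ))
  (thetaDiv : ℤ → ℤ → LgpDivisor M (thetaIndex X).lstar)
  (n : ℤ) {HT : Type} {LogLink : HT → HT → Type} {IsFull : ∀ {s t : HT}, LogLink s t → Prop}
  (lat : LGPGaussianLogThetaLattice LogLink IsFull)
  {Frd : Type} {IsoF : Frd → Frd → Type} {Ob : Frd → Type} {realify : Frd → Frd} {Strip : Type}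
  {IsoS : Strip → Strip → Type} {Mv : ∀ v : (thetaIndex X).V, v ∈ (thetaIndex X).Vbad → Type}
  [∀ v h, Monoid (Mv v h)]
  (sig : GlobalLGPFrobenioidSignature (thetaIndex X).lstar (thetaIndex X).V (· ∈ (thetaIndex X).Vbad)
    Frd IsoF Ob realify Strip IsoS Mv)
  (split : SplittingMonoids Mv) {ObΔ : Type} {N : ∀ v : (thetaIndex X).V, v ∈ (thetaIndex X).Vbad → Type}
  [∀ v h, Monoid (N v h)] (qData : QPilotData ObΔ N)
  (tq : ∀ (pp : Nat.Primes) (x : (thetaIndex X).Fibre (.inr pp)), haveI : Fact (pp : ℕ).Prime := ⟨pp.2⟩; kOf X pp.1 x)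
  (htq0 : ∀ pp x, tq pp x ≠ 0)
  (htq1 : ∀ (pp : Nat.Primes) (x : (thetaIndex X).Fibre (.inr pp)),
    haveI : Fact (pp : ℕ).Prime := ⟨pp.2⟩; placeOf X pp.1 x ∉ X.S → ‖tq pp x‖ = 1)

/-- **The two Y-26 frames carry the same pins**: `PinnedRegions` over the Dupuy–Hilado-weighted lattice situation at `settingDHVolSharp` ⟺
`PinnedRegions` over the packet-normalised one at `settingPrVolSharp` (`Iff.rfl`). [claim: Mochizuki2012, status: disputed] -/
theorem pinnedRegions_ofShells_settingDHVolSharp_iff_settingPrVolSharp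
    (t : ∀ (pp : Nat.Primes) (_ : Fin X.lstar) (x : (thetaIndex X).Fibre (.inr pp)), haveI : Fact (pp : ℕ).Prime := ⟨pp.2⟩; kOf X pp.1 x)
    (ρ : (∀ v : (thetaIndex X).V, v ∈ (thetaIndex X).Vbad → Set ((logShellsDH X (analyticLogv F)).StarPacket v)) →
      ∀ (j : (thetaIndex X).Label) (vQ : (thetaIndex X).VQ), Set ((logShellsDH X (analyticLogv F)).Packet j vQ))
    (qK : ∀ v : (thetaIndex X).V, v ∈ (thetaIndex X).Vbad → Set ((logShellsDH X (analyticLogv F)).StarPacket v)) :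
    Cor312Vol.PinnedRegions
        (LatticeSituation.ofShells (logShellsDH X (analyticLogv F)) M archPk archSub
          (summandPiecesDH X (logvAnalytic_analyticLogv (F := F))).Adm
          (summandPiecesDH X (logvAnalytic_analyticLogv (F := F))).logvol Ψ act Mmod region frobAdm frobLogvol frobΨ frobMmod
          unitImage ballImage thetaDiv)
        (settingDHVolSharp X (logvAnalytic_analyticLogv (F := F)) M archPk archSub Ψ act Mmod region n lat sig split qData tq t
          htq0 htq1) ρ qK ↔
      Cor312Vol.PinnedRegions
        (LatticeSituation.ofShells (logShellsDH X (analyticLogv F)) M archPk archSub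
          (summandPiecesPr X (logvAnalytic_analyticLogv (F := F))).Adm
          (summandPiecesPr X (logvAnalytic_analyticLogv (F := F))).logvol Ψ act Mmod region frobAdm frobLogvol frobΨ frobMmod
          unitImage ballImage thetaDiv)
        (settingPrVolSharp X (logvAnalytic_analyticLogv (F := F)) M archPk archSub Ψ act Mmod region n lat sig split qData tq t
          htq0 htq1) ρ qK :=
  Iff.rfl

/-- … and the same for `PinnedRegions3`. [claim: Mochizuki2012, status: disputed] -/
theorem pinnedRegions3_ofShells_settingDHVolSharp_iff_settingPrVolSharp
    (t : ∀ (pp : Nat.Primes) (_ : Fin X.lstar) (x : (thetaIndex X).Fibre (.inr pp)), haveI : Fact (pp : ℕ).Prime := ⟨pp.2⟩; kOf X pp.1 x)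
    (ρ : (∀ v : (thetaIndex X).V, v ∈ (thetaIndex X).Vbad → Set ((logShellsDH X (analyticLogv F)).StarPacket v)) →
      ∀ (j : (thetaIndex X).Label) (vQ : (thetaIndex X).VQ), Set ((logShellsDH X (analyticLogv F)).Packet j vQ))
    (qK : ∀ v : (thetaIndex X).V, v ∈ (thetaIndex X).Vbad → Set ((logShellsDH X (analyticLogv F)).StarPacket v)) :
    Cor312Vol.PinnedRegions3
        (LatticeSituation.ofShells (logShellsDH X (analyticLogv F)) M archPk archSub
          (summandPiecesDH X (logvAnalytic_analyticLogv (F := F))).Adm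
          (summandPiecesDH X (logvAnalytic_analyticLogv (F := F))).logvol Ψ act Mmod region frobAdm frobLogvol frobΨ frobMmod
          unitImage ballImage thetaDiv)
        (settingDHVolSharp X (logvAnalytic_analyticLogv (F := F)) M archPk archSub Ψ act Mmod region n lat sig split qData tq t
          htq0 htq1) ρ qK ↔
      Cor312Vol.PinnedRegions3
        (LatticeSituation.ofShells (logShellsDH X (analyticLogv F)) M archPk archSub
          (summandPiecesPr X (logvAnalytic_analyticLogv (F := F))).Adm
          (summandPiecesPr X (logvAnalytic_analyticLogv (F := F))).logvol Ψ act Mmod region frobAdm frobLogvol frobΨ frobMmod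
          unitImage ballImage thetaDiv)
        (settingPrVolSharp X (logvAnalytic_analyticLogv (F := F)) M archPk archSub Ψ act Mmod region n lat sig split qData tq t
          htq0 htq1) ρ qK :=
  Iff.rfl

/-- **THE Y-26 CRITERION AT THE VERBATIM-VOLUME SHARP CARRIER `settingDHVolSharp`**, every Θ-ideles `t`: `(∃ ρ qK, PinnedRegions …) ↔ [F:ℚ] = 1`
over the Dupuy–Hilado-weighted frame — ★ p527356's packet-normalised criterion transported along §1's `Iff.rfl`.
[claim: Mochizuki2012, status: disputed] [cite: DupuyHilado2025, §3.6, §4.9] -/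
theorem exists_pinnedRegions_settingDHVolSharp_iff_finrank_eq_one
    (t : ∀ (pp : Nat.Primes) (_ : Fin X.lstar) (x : (thetaIndex X).Fibre (.inr pp)), haveI : Fact (pp : ℕ).Prime := ⟨pp.2⟩; kOf X pp.1 x) :
    (∃ (ρ : (∀ v : (thetaIndex X).V, v ∈ (thetaIndex X).Vbad → Set ((logShellsDH X (analyticLogv F)).StarPacket v)) →
          ∀ (j : (thetaIndex X).Label) (vQ : (thetaIndex X).VQ), Set ((logShellsDH X (analyticLogv F)).Packet j vQ))
      (qK : ∀ v : (thetaIndex X).V, v ∈ (thetaIndex X).Vbad → Set ((logShellsDH X (analyticLogv F)).StarPacket v)),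
      Cor312Vol.PinnedRegions
        (LatticeSituation.ofShells (logShellsDH X (analyticLogv F)) M archPk archSub
          (summandPiecesDH X (logvAnalytic_analyticLogv (F := F))).Adm
          (summandPiecesDH X (logvAnalytic_analyticLogv (F := F))).logvol Ψ act Mmod region frobAdm frobLogvol frobΨ frobMmod
          unitImage ballImage thetaDiv)
        (settingDHVolSharp X (logvAnalytic_analyticLogv (F := F)) M archPk archSub Ψ act Mmod region n lat sig split qData tq t
          htq0 htq1) ρ qK) ↔
      Module.finrank ℚ F = 1 :=
  (exists_congr fun ρ => exists_congr fun qK => pinnedRegions_ofShells_settingDHVolSharp_iff_settingPrVolSharp X M archPk archSub Ψ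
      act Mmod region frobAdm frobLogvol frobΨ frobMmod unitImage ballImage thetaDiv n lat sig split qData tq htq0 htq1 t ρ qK).trans
    (exists_pinnedRegions_settingPrVolSharp_iff_finrank_eq_one₀ X M archPk archSub Ψ act Mmod region frobAdm frobLogvol frobΨ frobMmod
      unitImage ballImage thetaDiv n lat sig split qData tq htq0 htq1 t)

/-- **EVERY `F ≠ ℚ` is KERNEL-EMPTY at `settingDHVolSharp`** — w4-d087's tame-place negatives (`Cor312PinnedThetaRealSharpNegative*`) are the
special case with a place hypothesis; here none. [claim: Mochizuki2012, status: disputed] -/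
theorem not_pinnedRegions_settingDHVolSharp_of_one_lt_finrank
    (t : ∀ (pp : Nat.Primes) (_ : Fin X.lstar) (x : (thetaIndex X).Fibre (.inr pp)), haveI : Fact (pp : ℕ).Prime := ⟨pp.2⟩; kOf X pp.1 x)
    (hF : 1 < Module.finrank ℚ F)
    (ρ : (∀ v : (thetaIndex X).V, v ∈ (thetaIndex X).Vbad → Set ((logShellsDH X (analyticLogv F)).StarPacket v)) →
      ∀ (j : (thetaIndex X).Label) (vQ : (thetaIndex X).VQ), Set ((logShellsDH X (analyticLogv F)).Packet j vQ))
    (qK : ∀ v : (thetaIndex X).V, v ∈ (thetaIndex X).Vbad → Set ((logShellsDH X (analyticLogv F)).StarPacket v)) :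
    ¬ Cor312Vol.PinnedRegions
        (LatticeSituation.ofShells (logShellsDH X (analyticLogv F)) M archPk archSub
          (summandPiecesDH X (logvAnalytic_analyticLogv (F := F))).Adm
          (summandPiecesDH X (logvAnalytic_analyticLogv (F := F))).logvol Ψ act Mmod region frobAdm frobLogvol frobΨ frobMmod
          unitImage ballImage thetaDiv)
        (settingDHVolSharp X (logvAnalytic_analyticLogv (F := F)) M archPk archSub Ψ act Mmod region n lat sig split qData tq t
          htq0 htq1) ρ qK := fun h =>
  absurd ((exists_pinnedRegions_settingDHVolSharp_iff_finrank_eq_one X M archPk archSub Ψ act Mmod region frobAdm frobLogvol frobΨ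
    frobMmod unitImage ballImage thetaDiv n lat sig split qData tq htq0 htq1 t).1 ⟨ρ, qK, h⟩) (by omega)

/-- **Negated universal form at `settingDHVolSharp`**: `(∀ ρ qK, ¬ PinnedRegions …) ↔ 1 < [F:ℚ]`. [claim: Mochizuki2012, status: disputed] -/
theorem forall_not_pinnedRegions_settingDHVolSharp_iff_one_lt_finrank
    (t : ∀ (pp : Nat.Primes) (_ : Fin X.lstar) (x : (thetaIndex X).Fibre (.inr pp)), haveI : Fact (pp : ℕ).Prime := ⟨pp.2⟩; kOf X pp.1 x) :
    (∀ (ρ : (∀ v : (thetaIndex X).V, v ∈ (thetaIndex X).Vbad → Set ((logShellsDH X (analyticLogv F)).StarPacket v)) →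
          ∀ (j : (thetaIndex X).Label) (vQ : (thetaIndex X).VQ), Set ((logShellsDH X (analyticLogv F)).Packet j vQ))
      (qK : ∀ v : (thetaIndex X).V, v ∈ (thetaIndex X).Vbad → Set ((logShellsDH X (analyticLogv F)).StarPacket v)),
      ¬ Cor312Vol.PinnedRegions
        (LatticeSituation.ofShells (logShellsDH X (analyticLogv F)) M archPk archSub
          (summandPiecesDH X (logvAnalytic_analyticLogv (F := F))).Adm
          (summandPiecesDH X (logvAnalytic_analyticLogv (F := F))).logvol Ψ act Mmod region frobAdm frobLogvol frobΨ frobMmod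
          unitImage ballImage thetaDiv)
        (settingDHVolSharp X (logvAnalytic_analyticLogv (F := F)) M archPk archSub Ψ act Mmod region n lat sig split qData tq t
          htq0 htq1) ρ qK) ↔
      1 < Module.finrank ℚ F := by
  have h := (exists_pinnedRegions_settingDHVolSharp_iff_finrank_eq_one X M archPk archSub Ψ act Mmod region frobAdm frobLogvol frobΨ
    frobMmod unitImage ballImage thetaDiv n lat sig split qData tq htq0 htq1 t).not
  simp only [not_exists] at h
  have hpos : 0 < Module.finrank ℚ F := Module.finrank_pos
  rw [h]; omega

/-- **Three-pin form at `settingDHVolSharp`**: `(∃ ρ qK, PinnedRegions3 …) ↔ [F:ℚ] = 1 ∧ Nonempty (Ob sig.Clgp ≃ ObΔ)` (★ p524016's residual binder).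
[claim: Mochizuki2012, status: disputed] -/
theorem exists_pinnedRegions3_settingDHVolSharp_iff_finrank_eq_one_and_nonempty_equiv
    (t : ∀ (pp : Nat.Primes) (_ : Fin X.lstar) (x : (thetaIndex X).Fibre (.inr pp)), haveI : Fact (pp : ℕ).Prime := ⟨pp.2⟩; kOf X pp.1 x) :
    (∃ (ρ : (∀ v : (thetaIndex X).V, v ∈ (thetaIndex X).Vbad → Set ((logShellsDH X (analyticLogv F)).StarPacket v)) →
          ∀ (j : (thetaIndex X).Label) (vQ : (thetaIndex X).VQ), Set ((logShellsDH X (analyticLogv F)).Packet j vQ))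
      (qK : ∀ v : (thetaIndex X).V, v ∈ (thetaIndex X).Vbad → Set ((logShellsDH X (analyticLogv F)).StarPacket v)),
      Cor312Vol.PinnedRegions3
        (LatticeSituation.ofShells (logShellsDH X (analyticLogv F)) M archPk archSub
          (summandPiecesDH X (logvAnalytic_analyticLogv (F := F))).Adm
          (summandPiecesDH X (logvAnalytic_analyticLogv (F := F))).logvol Ψ act Mmod region frobAdm frobLogvol frobΨ frobMmod
          unitImage ballImage thetaDiv)
        (settingDHVolSharp X (logvAnalytic_analyticLogv (F := F)) M archPk archSub Ψ act Mmod region n lat sig split qData tq t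
          htq0 htq1) ρ qK) ↔
      Module.finrank ℚ F = 1 ∧ Nonempty (Ob sig.Clgp ≃ ObΔ) :=
  (exists_congr fun ρ => exists_congr fun qK => pinnedRegions3_ofShells_settingDHVolSharp_iff_settingPrVolSharp X M archPk archSub Ψ
      act Mmod region frobAdm frobLogvol frobΨ frobMmod unitImage ballImage thetaDiv n lat sig split qData tq htq0 htq1 t ρ qK).trans
    (exists_pinnedRegions3_settingPrVolSharp_iff_finrank_eq_one_and_nonempty_equiv₀ X M archPk archSub Ψ act Mmod region frobAdm
      frobLogvol frobΨ frobMmod unitImage ballImage thetaDiv n lat sig split qData tq htq0 htq1 t)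

/-- **Three-pin form at `settingDHVolSharp`, one-point context data**: `(∃ ρ qK, PinnedRegions3 …) ↔ [F:ℚ] = 1`, hypothesis-free.
[claim: Mochizuki2012, status: disputed] -/
theorem exists_pinnedRegions3_settingDHVolSharp_unit_iff_finrank_eq_one
    (t : ∀ (pp : Nat.Primes) (_ : Fin X.lstar) (x : (thetaIndex X).Fibre (.inr pp)), haveI : Fact (pp : ℕ).Prime := ⟨pp.2⟩; kOf X pp.1 x) :
    (∃ (ρ : (∀ v : (thetaIndex X).V, v ∈ (thetaIndex X).Vbad → Set ((logShellsDH X (analyticLogv F)).StarPacket v)) →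
          ∀ (j : (thetaIndex X).Label) (vQ : (thetaIndex X).VQ), Set ((logShellsDH X (analyticLogv F)).Packet j vQ))
      (qK : ∀ v : (thetaIndex X).V, v ∈ (thetaIndex X).Vbad → Set ((logShellsDH X (analyticLogv F)).StarPacket v)),
      Cor312Vol.PinnedRegions3
        (LatticeSituation.ofShells (logShellsDH X (analyticLogv F)) M archPk archSub
          (summandPiecesDH X (logvAnalytic_analyticLogv (F := F))).Adm
          (summandPiecesDH X (logvAnalytic_analyticLogv (F := F))).logvol Ψ act Mmod region frobAdm frobLogvol frobΨ frobMmod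
          unitImage ballImage thetaDiv)
        (settingDHVolSharp X (logvAnalytic_analyticLogv (F := F)) M archPk archSub Ψ act Mmod region n lat (unitSigDH X)
          (unitSplitDH X) (unitQDataDH X) tq t htq0 htq1) ρ qK) ↔
      Module.finrank ℚ F = 1 := by
  rw [exists_pinnedRegions3_settingDHVolSharp_iff_finrank_eq_one_and_nonempty_equiv]
  exact ⟨fun h => h.1, fun h => ⟨h, ⟨Equiv.refl Unit⟩⟩⟩

end Criterion

end GenuinePinsDHNormalisation

end Summit.ABC.IUTFork.Joshi

end
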